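import Summits.QuantumFields.BalabanUV.T4Continuum.Spine.NE9.DirectPairing
import Summits.QuantumFields.BalabanUV.T4Continuum.Spine.NE9.MemoryFromRateSharp
import Summits.QuantumFields.BalabanUV.T4Continuum.Spine.NE9.TowerCarriersBox

/-!
# T⁴ programme, spine estimate NE9 — KING'S CURRENCY IS TWO-SIDED AT «SEPARATE UNIFORM CONTINUITY»: the SLOW TOWER of row C26
# (bracket `≍ 1∕m`, `¬ Summable δ` in the consecutive currency) PASSES `DirectPairing.bracket_eventually_le`, and a CONTINUOUS but not
# uniformly continuous tower (`sin t²` in the age-two coupling) FAILS it for EVERY positive profile — census item C30 of cell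
# `pub-balaban-gaps`, seat ne9 (gen 6), the witnesses (E-side: `DirectPairing`; U6 side: `DirectPairingCauchy`)

Cell `pub-balaban-gaps` (YM blitz G2, seat ne9, unit `pub-balaban-gaps-ne9-g6`; record `run/shared/lean/pub/pub-balaban-gaps/ne/NE9.md`
§5 row C30).  Summits-side bookkeeping; ONE definition (`wildTower`, the necessity witness); by-name inputs: gen 4's `MemoryFromRateSharp`
(`slowMod`, `slowTower`, `continuous_slowMod`, `slowTower_rate`, `pair_mem_window`, `not_summable_delta`), gen 3's `MemoryFromRate`
(`shift_mem_window`, `mix_mem_window`), gen 5's `TowerCarriersBox` (`shift_mem_boxWindow`, `mix_mem_boxWindow`) and this gen's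
`DirectPairing.bracket_eventually_le`.

WHAT IS PROVED.
* §1 THE SLOW TOWER PASSES.  `uniformContinuous_slowMod`: `φ(t) = (1 + |log|t||)⁻¹` is uniformly continuous on `ℝ` (continuous, and `→ 0`
  along `cocompact ℝ = atBot ⊔ atTop`); hence `slowTower γ` is separately uniformly continuous per level (`slowTower_sepUC`), and — with its
  exact tower rate and age-two dependence — `slowTower_bracket_eventually_le`: for EVERY profile `P → 0` and `η > 0` the bracket of every
  admissible pair under `P` is `≤ η` from some level on.  The SAME tower along node U2's geometric profile has `¬ Summable
  (T4CauchySum.delta E ρ inj)` for every dominating injection (row C26; recalled in `slowTower_separates`): the consecutive (ℓ¹) and King's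
  (c₀) organisations of node U6 DIFFER on the E-side, exactly at C26's witness.
* §2 UNIFORMITY IS NECESSARY.  `wildTower m t = sin((t_{m−2})²)` (`m ≥ 2`; `0` below) on the t-box `BoxWindow [t₀, ∞[`: every level is
  continuous (`continuous_wildTower`), bounded by `1`, has the exact tower rate (`wildTower_rate`, `θ⁻¹θ^m` for every `θ > 0`) and
  age-two dependence (`wildTower_congr`); yet for EVERY level `m ≥ 2` and EVERY `P > 0` there is an admissible pair agreeing off the
  coordinate `m − 2`, differing there by `≤ P`, whose terms differ by EXACTLY `2` (`wildTower_pair`: `τ² = 2π(N+1) − π∕2`, `τ′² = τ² + π`,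
  `τ′ − τ ≤ π∕(2τ)`) — so `wildTower_not_eventually_small`: the conclusion of `bracket_eventually_le` FAILS for every positive profile
  although every OTHER hypothesis of it holds (`wildTower_hyps`), and (`wildTower_not_sepUC`) the tower is not separately uniformly
  continuous.  Continuity per coupling is therefore NOT enough in King's currency either; separate UNIFORM continuity is — and print's
  clause for the last coupling is stated on the CLOSED interval `[0, γ]` ([Balaban1987RG1] p. 263 *"It is a C^∞-function of
  g_{j−1} ∈ [0, γ]"*), a TYPE that gives uniform continuity (in `g`, hence in `t = 1∕g²` on `[γ⁻², ∞[`).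

HONEST FRAMING: real analysis on hypothesis SHAPES and two toy towers; nothing is instantiated on Bałaban's objects (instance 0∕1); NE9 and
NE5 NOT PRINTED ∕ NOT PROVED; spine PROVED 0∕9 unchanged; rung (B)+1 on ONE finite four-torus; NOT UV stability, NOT the continuum limit,
NOT infinite volume, NOT a mass gap, NOT Clay.  Classification of NE9 UNCHANGED in kind (WORK-bound on W1).

References (TYPES only): [Balaban1987RG1] = T. Bałaban, Commun. Math. Phys. **109** (1987) 249–301, p. 263; [King1986] = C. King, Commun.
Math. Phys. **102** (1986) 649–677, Thm 3.4 p. 656.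
-/

namespace Summit.QuantumFields.BalabanUV.T4Continuum.NE9.DirectPairingSharp

open scoped BigOperators
open Finset Filter Topology
open Literature.MathematicalPhysics.QuantumFieldTheory.Balaban1983to89
open Literature.MathematicalPhysics.QuantumFieldTheory.Balaban1983to89.T4OutputRate
open Literature.MathematicalPhysics.QuantumFieldTheory.Balaban1983to89.T4CouplingAnalyticity (BoxWindow)
open T4CauchySum (delta)
open Summit.QuantumFields.BalabanUV.T4Continuum.NE9.MemoryFromRate (shift_mem_window mix_mem_window)
open Summit.QuantumFields.BalabanUV.T4Continuum.NE9.MemoryFromRateSharp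
open Summit.QuantumFields.BalabanUV.T4Continuum.NE9.TowerCarriersBox (shift_mem_boxWindow mix_mem_boxWindow)
open Summit.QuantumFields.BalabanUV.T4Continuum.NE9.DirectPairing (bracket_eventually_le)

/-! ## §1 The slow tower of row C26 PASSES in King's currency -/

/-- `φ → 0` at `+∞`. [folklore] -/
theorem tendsto_slowMod_atTop : Tendsto slowMod atTop (𝓝 0) := by
  have h1 : Tendsto (fun x : ℝ => 1 + |Real.log x|) atTop atTop :=
    tendsto_atTop_add_const_left _ 1 (tendsto_abs_atTop_atTop.comp Real.tendsto_log_atTop)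
  refine h1.inv_tendsto_atTop.congr' ?_
  filter_upwards [eventually_gt_atTop 0] with x hx
  simp only [Pi.inv_apply]
  exact (slowMod_of_ne_zero hx.ne').symm

/-- `φ → 0` at `−∞` (`Real.log x = log|x|`). [folklore] -/
theorem tendsto_slowMod_atBot : Tendsto slowMod atBot (𝓝 0) := by
  have h0 : Tendsto (fun x : ℝ => Real.log x) atBot atTop := by
    have h := Real.tendsto_log_atTop.comp tendsto_abs_atBot_atTop
    exact h.congr fun x => Real.log_abs x
  have h1 : Tendsto (fun x : ℝ => 1 + |Real.log x|) atBot atTop :=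
    tendsto_atTop_add_const_left _ 1 (tendsto_abs_atTop_atTop.comp h0)
  refine h1.inv_tendsto_atTop.congr' ?_
  filter_upwards [eventually_lt_atBot 0] with x hx
  simp only [Pi.inv_apply]
  exact (slowMod_of_ne_zero hx.ne).symm

/-- **THE SLOW MODULUS IS UNIFORMLY CONTINUOUS ON `ℝ`** (continuous and vanishing at infinity). [folklore] -/
theorem uniformContinuous_slowMod : UniformContinuous slowMod := by
  refine continuous_slowMod.uniformContinuous_of_tendsto_cocompact (x := 0) ?_
  rw [cocompact_eq_atBot_atTop]
  exact tendsto_slowMod_atBot.sup tendsto_slowMod_atTop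

/-- ε–δ form of `uniformContinuous_slowMod` with non-strict inequalities. [folklore] -/
theorem slowMod_modulus {ε : ℝ} (hε : 0 < ε) : ∃ δ : ℝ, 0 < δ ∧ ∀ a b : ℝ, |a - b| ≤ δ → |slowMod a - slowMod b| ≤ ε := by
  obtain ⟨δ, hδ, h⟩ := Metric.uniformContinuous_iff.mp uniformContinuous_slowMod ε hε
  refine ⟨δ / 2, half_pos hδ, fun a b hab => ?_⟩
  have hd : dist a b < δ := by
    rw [Real.dist_eq]
    linarith
  have h' := h hd
  rw [Real.dist_eq] at h'
  exact h'.le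

/-- **THE SLOW TOWER IS SEPARATELY UNIFORMLY CONTINUOUS, PER LEVEL** (on any window): the hypothesis `hUC` of
`DirectPairing.bracket_eventually_le`. [folklore] -/
theorem slowTower_sepUC (γ : ℝ) (W : Set (ℕ → ℝ)) :
    ∀ m i : ℕ, i < m → ∀ ε : ℝ, 0 < ε → ∃ δ : ℝ, 0 < δ ∧ ∀ g ∈ W, ∀ g' ∈ W,
      (∀ k, k ≠ i → g k = g' k) → |g i - g' i| ≤ δ → |slowTower γ m g - slowTower γ m g'| ≤ ε := by
  intro m i _ ε hε
  obtain ⟨δ, hδ, h⟩ := slowMod_modulus hε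
  refine ⟨δ, hδ, fun g _ g' _ hagree hdiff => ?_⟩
  rcases Nat.lt_or_ge m 2 with hm | hm
  · rw [slowTower_of_lt hm, slowTower_of_lt hm, sub_self, abs_zero]
    exact hε.le
  · rw [slowTower_of_le hm, slowTower_of_le hm]
    by_cases hi : m - 2 = i
    · refine h _ _ ?_
      rw [show g (m - 2) - γ / 2 - (g' (m - 2) - γ / 2) = g (m - 2) - g' (m - 2) by ring, hi]
      exact hdiff
    · rw [hagree (m - 2) hi, sub_self, abs_zero]
      exact hε.le

/-- **THE SLOW TOWER PASSES IN KING'S CURRENCY.**  On the window `]0, γ]`, for EVERY profile `P → 0` and `η > 0` there is a level beyond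
which every admissible pair under `P` has bracket `≤ η` — `DirectPairing.bracket_eventually_le` BY NAME, fed with the exact tower rate
(`slowTower_rate` at `θ = 1∕2`, `C₅ = 2`), age-two dependence (prefix dependence) and `slowTower_sepUC`. [folklore] -/
theorem slowTower_bracket_eventually_le (γ : ℝ) {P : ℕ → ℝ} (hP : Tendsto P atTop (𝓝 0)) {η : ℝ} (hη : 0 < η) :
    ∃ M₀ : ℕ, ∀ m : ℕ, M₀ ≤ m → ∀ g ∈ Window γ, ∀ g' ∈ Window γ,
      (∀ i, i < m → |g i - g' i| ≤ P i) → |slowTower γ m g - slowTower γ m g'| ≤ η := by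
  have hT : ∀ m, ∀ g ∈ Window γ,
      |slowTower γ (m + 1) g - slowTower γ m (fun i => g (i + 1))| ≤ 2 * (1 / 2 : ℝ) ^ m := fun m g _ => by
    have h := slowTower_rate γ (show (0 : ℝ) < 1 / 2 by norm_num) m g
    norm_num at h ⊢
    exact h
  have hPref : ∀ m, ∀ g ∈ Window γ, ∀ g' ∈ Window γ, (∀ i, i < m → g i = g' i) →
      slowTower γ m g = slowTower γ m g' := fun m g _ g' _ hagree => by
    rcases Nat.lt_or_ge m 2 with hm | hm
    · rw [slowTower_of_lt hm, slowTower_of_lt hm]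
    · exact slowTower_congr γ m (hagree (m - 2) (by omega))
  exact bracket_eventually_le (F := slowTower γ) (by norm_num) (by norm_num) (by norm_num)
    (fun g hg => shift_mem_window hg) (fun g hg g' hg' a => mix_mem_window hg hg' a) hT hPref
    (slowTower_sepUC γ (Window γ)) hP hη

/-- **… WHILE IT FAILS IN THE CONSECUTIVE CURRENCY** (row C26, `MemoryFromRateSharp.not_summable_delta`): for `γ > 0`, `0 < θ′ ≤ 1` there is
an admissible pair with EXACTLY node U2's geometric discrepancy `(γ∕2)θ′^i` along which no nonnegative injection dominating the bracket on
the diagonal has `Summable (delta E ρ inj)` (`E > 0`, `ρ ≥ 0`) — recorded next to the PASS so that one statement separates the two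
organisations of node U6 on the E-side. [folklore] -/
theorem slowTower_separates {γ θ' : ℝ} (hγ : 0 < γ) (hθ'0 : 0 < θ') (hθ'1 : θ' ≤ 1) :
    (∀ P : ℕ → ℝ, Tendsto P atTop (𝓝 0) → ∀ η : ℝ, 0 < η →
      ∃ M₀ : ℕ, ∀ m : ℕ, M₀ ≤ m → ∀ g ∈ Window γ, ∀ g' ∈ Window γ,
        (∀ i, i < m → |g i - g' i| ≤ P i) → |slowTower γ m g - slowTower γ m g'| ≤ η) ∧
    (∃ g ∈ Window γ, ∃ g' ∈ Window γ, (∀ i, |g i - g' i| = γ / 2 * θ' ^ i) ∧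
      ∀ E ρ : ℝ, 0 < E → 0 ≤ ρ → ∀ inj : ℕ → ℕ → ℝ, (∀ K j : ℕ, j ≤ K → 0 ≤ inj K j) →
        (∀ K, |slowTower γ K g - slowTower γ K g'| ≤ inj K K) → ¬ Summable (delta E ρ inj)) := by
  refine ⟨fun P hP η hη => slowTower_bracket_eventually_le γ hP hη, ?_⟩
  obtain ⟨hg, hg', hd⟩ := pair_mem_window hγ hθ'0.le hθ'1
  exact ⟨_, hg, _, hg', hd, fun E ρ hE hρ inj hinj hdom => not_summable_delta hγ hθ'0 hE hρ hinj hdom⟩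

/-! ## §2 Uniformity is necessary: the wild tower `sin t²` -/

/-- The WILD TOWER: `F m t = sin((t_{m−2})²)` for `m ≥ 2`, `0` below — continuous and bounded in every coupling, exact tower rate, age-two
dependence, but NOT uniformly continuous in its age-two coupling on `[t₀, ∞[`. [folklore] -/
noncomputable def wildTower (m : ℕ) (t : ℕ → ℝ) : ℝ :=
  if 2 ≤ m then Real.sin (t (m - 2) ^ 2) else 0

/-- Below level 2 the wild tower vanishes. [folklore] -/
theorem wildTower_of_lt {m : ℕ} (hm : m < 2) (t : ℕ → ℝ) : wildTower m t = 0 := by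
  simp [wildTower, not_le.mpr hm]

/-- From level 2 on it is `sin((t_{m−2})²)`. [folklore] -/
theorem wildTower_of_le {m : ℕ} (hm : 2 ≤ m) (t : ℕ → ℝ) : wildTower m t = Real.sin (t (m - 2) ^ 2) := by
  simp [wildTower, hm]

/-- `|F m t| ≤ 1`. [folklore] -/
theorem abs_wildTower_le (m : ℕ) (t : ℕ → ℝ) : |wildTower m t| ≤ 1 := by
  unfold wildTower
  split_ifs
  · exact Real.abs_sin_le_one _
  · simp

/-- **EVERY LEVEL IS CONTINUOUS** (product topology on histories). [folklore] -/
theorem continuous_wildTower (m : ℕ) : Continuous (wildTower m) := by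
  by_cases hm : 2 ≤ m
  · have e : wildTower m = fun t : ℕ → ℝ => Real.sin (t (m - 2) ^ 2) := by
      funext t
      simp [wildTower, hm]
    rw [e]
    exact Real.continuous_sin.comp ((continuous_apply (m - 2)).pow 2)
  · have e : wildTower m = fun _ => 0 := by
      funext t
      simp [wildTower, hm]
    rw [e]
    exact continuous_const

/-- **AGE-TWO DEPENDENCE ONLY** (prefix dependence; the last coupling does not enter). [folklore] -/
theorem wildTower_congr (m : ℕ) {t t' : ℕ → ℝ} (h : t (m - 2) = t' (m - 2)) : wildTower m t = wildTower m t' := by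
  unfold wildTower
  rw [h]

/-- **THE TOWER RATE, FOR EVERY HISTORY**: `|F (m+1) t − F m (t ∘ succ)| ≤ θ⁻¹·θ^m` for every `θ > 0` — exactly zero from `m = 2` on.
[folklore] -/
theorem wildTower_rate {θ : ℝ} (hθ : 0 < θ) (m : ℕ) (t : ℕ → ℝ) :
    |wildTower (m + 1) t - wildTower m (fun i => t (i + 1))| ≤ θ⁻¹ * θ ^ m := by
  rcases Nat.lt_or_ge m 2 with hm | hm
  · interval_cases m
    · rw [wildTower_of_lt (by norm_num), wildTower_of_lt (by norm_num), sub_self, abs_zero]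
      positivity
    · rw [wildTower_of_lt (by norm_num : 1 < 2), sub_zero, pow_one, inv_mul_cancel₀ hθ.ne']
      exact abs_wildTower_le _ _
  · rw [wildTower_of_le (by omega), wildTower_of_le hm, show m + 1 - 2 = m - 2 + 1 by omega, sub_self, abs_zero]
    positivity

/-- **EVERY HYPOTHESIS OF `bracket_eventually_le` EXCEPT SEPARATE UNIFORM CONTINUITY HOLDS** for the wild tower on the t-box `[t₀, ∞[^ℕ`:
shift- and hybrid-closed window, tower rate (`C₅ = 2`, `θ = 1∕2`), prefix dependence. [folklore] -/
theorem wildTower_hyps (t₀ : ℝ) :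
    (∀ g ∈ BoxWindow (Set.Ici t₀), (fun i => g (i + 1)) ∈ BoxWindow (Set.Ici t₀)) ∧
    (∀ g ∈ BoxWindow (Set.Ici t₀), ∀ g' ∈ BoxWindow (Set.Ici t₀), ∀ a : ℕ,
      (fun i => if i < a then g' i else g i) ∈ BoxWindow (Set.Ici t₀)) ∧
    (∀ m, ∀ g ∈ BoxWindow (Set.Ici t₀), |wildTower (m + 1) g - wildTower m (fun i => g (i + 1))| ≤ 2 * (1 / 2 : ℝ) ^ m) ∧
    (∀ m, ∀ g ∈ BoxWindow (Set.Ici t₀), ∀ g' ∈ BoxWindow (Set.Ici t₀), (∀ i, i < m → g i = g' i) →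
      wildTower m g = wildTower m g') := by
  refine ⟨fun g hg => shift_mem_boxWindow hg, fun g hg g' hg' a => mix_mem_boxWindow hg hg' a, fun m g _ => ?_,
    fun m g _ g' _ hagree => ?_⟩
  · have h := wildTower_rate (show (0 : ℝ) < 1 / 2 by norm_num) m g
    norm_num at h ⊢
    exact h
  · rcases Nat.lt_or_ge m 2 with hm | hm
    · rw [wildTower_of_lt hm, wildTower_of_lt hm]
    · exact wildTower_congr m (hagree (m - 2) (by omega))

/-- **THE WILD PAIR.**  For every threshold `t₀`, every level `m ≥ 2` and every `P > 0` there are two histories in the t-box `[t₀, ∞[^ℕ`,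
agreeing off the coordinate `m − 2` and differing there by at most `P`, whose level-`m` terms differ by EXACTLY `2`: the coordinate takes
the values `τ = √s` and `τ′ = √(s + π)` with `s = 2π(N+1) − π∕2` (`sin s = −1`, `sin(s + π) = 1`), `N` so large that `τ ≥ t₀` and
`τ ≥ π∕(2P)` (then `(τ + P)² ≥ s + π`, i.e. `τ′ ≤ τ + P`). [folklore] -/
theorem wildTower_pair (t₀ : ℝ) {m : ℕ} (hm : 2 ≤ m) {P : ℝ} (hP : 0 < P) :
    ∃ t ∈ BoxWindow (Set.Ici t₀), ∃ t' ∈ BoxWindow (Set.Ici t₀),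
      (∀ k, k ≠ m - 2 → t k = t' k) ∧ |t (m - 2) - t' (m - 2)| ≤ P ∧ |wildTower m t - wildTower m t'| = 2 := by
  have hπ := Real.pi_pos
  -- the radius to beat, and the index `N`
  set R : ℝ := max (max t₀ 0) (Real.pi / (2 * P)) with hR
  have hR0 : 0 ≤ R := (le_max_right _ _).trans (le_max_left _ _)
  have hRt₀ : t₀ ≤ R := (le_max_left _ _).trans (le_max_left _ _)
  have hRP : Real.pi / (2 * P) ≤ R := le_max_right _ _
  obtain ⟨N, hN⟩ : ∃ N : ℕ, R ^ 2 ≤ N := ⟨⌈R ^ 2⌉₊, Nat.le_ceil _⟩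
  -- `s = 2π(N+1) − π/2`, `sin s = −1`, `sin (s + π) = 1`, `s ≥ R²`
  set s : ℝ := -(Real.pi / 2) + ((N : ℝ) + 1) * (2 * Real.pi) with hs
  have hsin : Real.sin s = -1 := by
    have h := Real.sin_add_nat_mul_two_pi (-(Real.pi / 2)) (N + 1)
    push_cast at h
    rw [hs, h, Real.sin_neg, Real.sin_pi_div_two]
  have hsin' : Real.sin (s + Real.pi) = 1 := by
    rw [Real.sin_add_pi, hsin, neg_neg]
  have hsR : R ^ 2 ≤ s := by
    have hN0 : (0 : ℝ) ≤ N := Nat.cast_nonneg N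
    have : (N : ℝ) ≤ s := by
      rw [hs]
      nlinarith [Real.pi_gt_three]
    exact hN.trans this
  have hs0 : 0 ≤ s := (sq_nonneg R).trans hsR
  -- `τ = √s ≥ R`, `τ' = √(s + π)`, `τ ≤ τ' ≤ τ + P`
  set τ : ℝ := Real.sqrt s with hτ
  set τ' : ℝ := Real.sqrt (s + Real.pi) with hτ'
  have hτR : R ≤ τ := by
    rw [hτ, ← Real.sqrt_sq hR0]
    exact Real.sqrt_le_sqrt hsR
  have hτ0 : 0 ≤ τ := Real.sqrt_nonneg _
  have hττ' : τ ≤ τ' := Real.sqrt_le_sqrt (by linarith)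
  have hτ'le : τ' ≤ τ + P := by
    rw [hτ', Real.sqrt_le_iff]
    refine ⟨by linarith, ?_⟩
    have hτsq : τ ^ 2 = s := Real.sq_sqrt hs0
    have hπP : Real.pi ≤ 2 * τ * P := by
      have h1 : Real.pi / (2 * P) ≤ τ := hRP.trans hτR
      have h2 : Real.pi = Real.pi / (2 * P) * (2 * P) := by
        field_simp
      rw [h2]
      nlinarith
    nlinarith [sq_nonneg P]
  -- the two histories
  refine ⟨fun k => if k = m - 2 then τ else t₀, fun k => ?_, fun k => if k = m - 2 then τ' else t₀, fun k => ?_,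
    fun k hk => by simp [hk], ?_, ?_⟩
  · by_cases hk : k = m - 2
    · simp only [hk, if_true, Set.mem_Ici]
      exact hRt₀.trans hτR
    · simp [hk]
  · by_cases hk : k = m - 2
    · simp only [hk, if_true, Set.mem_Ici]
      exact hRt₀.trans (hτR.trans hττ')
    · simp [hk]
  · simp only [if_true]
    rw [abs_sub_comm, abs_of_nonneg (by linarith)]
    linarith
  · rw [wildTower_of_le hm, wildTower_of_le hm]
    simp only [if_true]
    rw [hτ, hτ', Real.sq_sqrt hs0, Real.sq_sqrt (by linarith), hsin, hsin']
    norm_num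

/-- **UNIFORMITY IS NECESSARY IN KING'S CURRENCY.**  For the wild tower on the t-box `[t₀, ∞[^ℕ` and EVERY positive profile `P` (in
particular every `P → 0`), the conclusion of `DirectPairing.bracket_eventually_le` FAILS: at every level `m ≥ 2` some admissible pair under
`P` has bracket `2`.  All the other hypotheses hold (`wildTower_hyps`, `continuous_wildTower`): continuity per coupling does not suffice.
[folklore] -/
theorem wildTower_not_eventually_small (t₀ : ℝ) {P : ℕ → ℝ} (hP : ∀ i, 0 < P i) :
    ¬ (∀ η : ℝ, 0 < η → ∃ M₀ : ℕ, ∀ m : ℕ, M₀ ≤ m → ∀ t ∈ BoxWindow (Set.Ici t₀), ∀ t' ∈ BoxWindow (Set.Ici t₀),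
      (∀ i, i < m → |t i - t' i| ≤ P i) → |wildTower m t - wildTower m t'| ≤ η) := by
  intro H
  obtain ⟨M₀, hM₀⟩ := H 1 one_pos
  set m := max M₀ 2 with hmdef
  obtain ⟨t, ht, t', ht', hagree, hdiff, htwo⟩ := wildTower_pair t₀ (m := m) (le_max_right _ _) (hP (m - 2))
  have h := hM₀ m (le_max_left _ _) t ht t' ht' fun i _ => by
    by_cases hi : i = m - 2
    · rw [hi]
      exact hdiff
    · rw [hagree i hi, sub_self, abs_zero]
      exact (hP i).le
  rw [htwo] at h
  norm_num at h

/-- … in particular the wild tower is NOT separately uniformly continuous (the hypothesis `hUC` fails at level `2`, coordinate `0`),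
although every level is continuous. [folklore] -/
theorem wildTower_not_sepUC (t₀ : ℝ) :
    ¬ (∀ m i : ℕ, i < m → ∀ ε : ℝ, 0 < ε → ∃ δ : ℝ, 0 < δ ∧
      ∀ t ∈ BoxWindow (Set.Ici t₀), ∀ t' ∈ BoxWindow (Set.Ici t₀),
        (∀ k, k ≠ i → t k = t' k) → |t i - t' i| ≤ δ → |wildTower m t - wildTower m t'| ≤ ε) := by
  intro H
  obtain ⟨δ, hδ, h⟩ := H 2 0 (by norm_num) 1 one_pos
  obtain ⟨t, ht, t', ht', hagree, hdiff, htwo⟩ := wildTower_pair t₀ (m := 2) le_rfl hδ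
  have h2 := h t ht t' ht' hagree hdiff
  rw [htwo] at h2
  norm_num at h2

end Summit.QuantumFields.BalabanUV.T4Continuum.NE9.DirectPairingSharp
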